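import Literature.MathematicalPhysics.QuantumFieldTheory.Balaban1983to89.B7Eq65AverageLipschitz
import Literature.MathematicalPhysics.QuantumFieldTheory.Balaban1983to89.B7Prop7Levels
import Literature.MathematicalPhysics.QuantumFieldTheory.Balaban1983to89.B8Ineq166Univ

/-!
# `Balaban1983to89.B8Ineq166OneLevelUp` — [Balaban1985RegularSpaces] (1.35) p. 82 ∕ (1.66) p. 87 in the p. 77 bond convention: THE
# (1.66) CURRENCY STEP «box ⊂ Ω_j at every level ⇒ box ⊂ Ω_{j−1}» — the box form of the averaged closeness (the N05 family letter
# `B8LeafModelZd3.zdGF3.avgClose166` AS TYPED) implies the closeness at every level-`j` bond whose two-block box lies in `Ω_{j−1}`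
# (the datum shape `h135` of the edition-γ driver `B8Eq142KLevelLocalGamma.H42_of_inAx_γ`), at the price `α₁ ↦ 26384(d+1)L·α₁`

statement-level skeleton of published theorems with citation tags; proofs where landed; nothing here is a claim about the
Yang–Mills mass gap

T. Bałaban, *Spaces of regular gauge field configurations on a lattice and gauge fixing conditions*, Commun. Math. Phys. **99** (1985)
75–102 `[Balaban1985RegularSpaces]` ("B8"; journal page = PDF page + 74): p. 77 *«If Ω ⊂ T_η then we denote by Ω also the set of bonds
st(Ω) = {bonds b ⊂ T: at least one end-point of b belongs to Ω}. … This convention applies to an arbitrary lattice.»*; (1.35) p. 82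
*«|\overline{U′U₀}ʲ − Ū₀ʲ| < α₁ on Λ_j, j = 0, 1, …, k»*; (1.65)∕(1.66) p. 87 *«… on Ω_j^{(j)}, j = 0, 1, …, k»*; (1.31) p. 82 (the crossing
bonds `b₋ ∈ Λ_{j−1}`, `b₊ ∈ Λ_j` of the axial gauge).  T. Bałaban, *Averaging operations for lattice gauge theories*, Commun. Math. Phys.
**98** (1985) 17–51 `[Balaban1985Averaging]` ("[3]"): (42)–(43) pp. 23–24 and the locality sentence after (43) *«Ū^k_c … depends only on the
bond variables U_b for b ⊂ B^k(c₋) ∪ B^k(c₊)»*, Prop. 2 (54) p. 26, Prop. 7 p. 43.  PDF held: `paper:balaban1985-cmp99-regular-spaces-gauge-fixing`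
pp. 77, 82–83, 87–88 read first-hand this session.

CITATION HEADER (lean-in-tree rule).  Cell `pub-ymgap` (HUMAN RULING D-0062 ∕ D-0149, Track A), DAG node N05 = [B8], width seat
`pub-ymgap-dag-n05-w2` (g0), key K1⁷ `stmt-QuantumFields-20542` (helper, count-neutral).  WHY THIS FILE.  `pub-ymgap-dag-n05-e` g9 LOCATED
(bus «LOCATED-AVG135», 2026-08-27 22:46Z) that the N05 family letter `zdGF3.avgClose166` reads (1.66) in the BOX FORM «for every level-`j` bond
whose two-block box lies in `Ω_j`» (both end-blocks in `Ω_j`), whereas the edition-γ driver of Theorem 4 (`B8Eq142KLevelLocalGamma.H42_of_inAx_γ`,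
`B8Thm4KLevelGamma`) must read the closeness at the level-`j` CROSSING bonds of (1.31) (one end-block in `Λ_j ⊂ Ω_j`, the other under `Λ_{j−1}`),
whose box lies in `Ω_{j−1}` but not in `Ω_j` — print's (1.35)∕(1.66) cover them by the p. 77 convention, the typed letter does not.  THIS FILE
closes that currency gap WITHOUT touching the letter: one step of the averaging (43) is LOCAL — `Ū^j(c)` reads the level-`(j−1)` bond variables of
`B(c₋) ∪ B(c₊)` only (`B7Prop1Local.bavg_congr`), and the `(j−1)`-boxes of those bonds lie inside the `j`-box of `c`, hence inside `Ω_{j−1}`,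
where the box-form letter AT LEVEL `j−1` applies — and LIPSCHITZ at a regular base ([3] (42)∕(65)∕Prop. 7 in the tree's reading
`B7Eq65AverageLipschitz.norm_bavg_sub_bavg_le`, constant `26384(d+1)L`; the base regularity of `Ū₀^{j−1}`'s block loops comes from (1.33) on the
box by the clamped extension `B7Prop1Local.clampCfg` + [3] Prop. 2 per level = `B7Prop7Levels.level_background_data`).

WHAT THIS FILE PROVES (kernel, 0 sorry, theorems only; `𝔸` a non-trivial C⋆-algebra, `U₀` unitary-valued, `U` ANY configuration — e.g.
`U = U′U₀`; `L ≥ 2`; windows `C₀α₀ ≤ 1∕3`, `8α₀ ≤ c₂′(d,L)`, `12288(d+1)L·α₁ ≤ 1`):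
* §1 `loK_succ_le_loK` ∕ `bondHiK_le_bondHiK_succ` ∕ `inBox_succ_of_inBox` (+ private `loK_le_bondHiK`) — the `(j−1)`-box of a level-`(j−1)` bond of `B(c₋) ∪ B(c₊)` lies in
  the `j`-box of the level-`j` bond `c` ([3] p. 24, the locality sentence; the arithmetic of `B7Prop1Local.avgIter_congr`).
* §2 ★ **`norm_avgIter_succ_sub_le_of_box`** — ONE LEVEL UP AT ONE BOND: if `U₀ ∈ 𝔄` at level `j` on the `(j+1)`-box of `c = ⟨z, z + e_μ⟩`
  ((1.33) there: `InAk`'s plaquette clause via `B8Ineq166Univ.pdevOn_box_lt_of_inAk`) and `‖Ūʲ(b) − Ū₀ʲ(b)‖ ≤ α₁` at every level-`j` bond `b`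
  whose box lies in that `(j+1)`-box, then `‖Ū^{j+1}(c) − Ū₀^{j+1}(c)‖ ≤ 26384(d+1)L·α₁`.
* §3 ★★ **`avgClose_predBox_of_boxForm`** — THE CURRENCY STEP AT ALL LEVELS: (1.33) `InAk L k η α₀ Ω U₀` and the box-form letter
  `∀ j ≤ k, ∀ z μ, (box_j(z,μ) ⊂ Ω_j) → ‖Ūʲ(z,μ) − Ū₀ʲ(z,μ)‖ ≤ α₁` (the first clause of `zdGF3.avgClose166 α₁`, with `U = U′U₀`) IMPLY
  `∀ j ≤ k, ∀ z μ, (box_j(z,μ) ⊂ Ω_{j−1}) → ‖Ūʲ(z,μ) − Ū₀ʲ(z,μ)‖ ≤ 26384(d+1)L·α₁` — VERBATIM the hypothesis `h135` of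
  `B8Eq142KLevelLocalGamma.H42_of_inAx_γ` with `α₁ ↦ 26384(d+1)L·α₁` (ℕ subtraction: level `0` is the letter itself).

HONEST SCOPE.  [folklore] bookkeeping over landed kernel theorems ([3] (42)–(43), Prop. 2, Prop. 7 through the cited modules); nothing of
[Balaban1985RegularSpaces] is asserted hypothesis-free; the constant `26384(d+1)L` and the windows are the tree's crude Cauchy-route witnesses
(`B7Eq65AverageLipschitz` (M3)), depending on `d, L` only — print needs no such step (its (1.35)∕(1.66) are stated in the one-end-point class);
this file only shows that the tree's WEAKER box-form hypothesis already controls the crossing bonds, so that the typed (stronger-than-print)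
Theorem 4 ∕ Theorem 2 on `zdGF3` stay reachable by the γ driver with `B₁′` enlarged by a `d, L` factor.  Count-neutral; N05 NOT discharged; one
finite `𝕋⁴` programme at fixed `ε`, Bałaban AS PRINTED; the Yang–Mills mass gap (Clay) is NOT proved by any of this — R4 closes the conditional
finite-`𝕋⁴` rung `BalabanLadder.UV` only; nothing continuum ∕ ℝ⁴ ∕ OS ∕ mass-gap.  No `sorry`, no `def`, no `instance`, no `notation`.
Unit `pub-ymgap-dag-n05-w2` (g0), 2026-08-27.  Tree API by name only, nothing restated.

RELATED IN THE TREE, NOT DUPLICATED: `B8Ineq165AllLevels` ∕ `B8Ineq165GradedCover` ∕ `B8Ineq166Univ` ((1.33)–(1.35) ⇒ (1.66) in the «box ⊂ Ω_ℓ»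
currency — their HONEST SCOPE: «print's «on Ω_j^{(j)}» with the touching convention is not claimed for bonds leaving Ω_j»; this file is that
missing step, one level at a time, for ANY configuration `U` given the box-form closeness itself); `B7Eq65AverageLipschitz` (USED: the one-step
Lipschitz bound); `B7Prop1Local` (USED: locality, clamp); `B7Prop7Levels` (USED: level backgrounds); `B8Eq142KLevelLocalGamma` (the consumer's
hypothesis shape; not imported).
-/

noncomputable section

namespace Literature.MathematicalPhysics.QuantumFieldTheory.Balaban1983to89.B8Ineq166OneLevelUp

open B7Prop1Explicit B7Prop2Explicit B7Prop1Local
open B8Ineq132 (InAk)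
open B7Eq65AverageLipschitz (norm_bavg_sub_bavg_le)
open B7Prop7Levels (level_background_data)
open B8Ineq166Univ (pdevOn_box_lt_of_inAk)

-- `Site` alone could resolve to the torus sites of `Setup.lean`; re-export the `ℤ^d` sites of `B7Prop1Explicit`.
export B7Prop1Explicit (Site)

variable {d : ℕ}

/-! ## §1 The `j`-box of a level-`j` bond of `B(c₋) ∪ B(c₊)` lies in the `(j+1)`-box of `c` -/

/-- Lower corners: for a level-`j` site `y` of the block pair `[Lz, Lz + (L−1)𝟙 + Le_μ]` under the level-`(j+1)` bond `⟨z, z + e_μ⟩`,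
`L^{j+1}z ≤ Lʲy` coordinatewise. [cite: Balaban1985Averaging, p.24 (locality sentence after (43))] -/
theorem loK_succ_le_loK (L j : ℕ) (z : Site d) (μ : Fin d) {y : Site d} (hy : InBox ((L : ℤ) • z) (bondHi L ((L : ℤ) • z) μ) y)
    (i : Fin d) : loK L (j + 1) z i ≤ loK L j y i := by
  have hP : (0 : ℤ) ≤ (L : ℤ) ^ j := by positivity
  have h1 := (hy i).1
  simp only [Pi.smul_apply, smul_eq_mul] at h1
  have h1' := mul_le_mul_of_nonneg_left h1 hP
  simp only [loK, pow_succ]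
  nlinarith

/-- Upper corners: for a level-`j` bond `⟨y, y + e_ν⟩` with both end-points in the block pair under `⟨z, z + e_μ⟩`, the upper corner of its
`j`-box is below the upper corner of the `(j+1)`-box of `⟨z, z + e_μ⟩`. [cite: Balaban1985Averaging, p.24 (locality sentence after (43))] -/
theorem bondHiK_le_bondHiK_succ (L j : ℕ) (z : Site d) (μ : Fin d) {y : Site d} {ν : Fin d}
    (hy : InBox ((L : ℤ) • z) (bondHi L ((L : ℤ) • z) μ) y) (hye : InBox ((L : ℤ) • z) (bondHi L ((L : ℤ) • z) μ) (y + e ν))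
    (i : Fin d) : bondHiK L j y ν i ≤ bondHiK L (j + 1) z μ i := by
  have hP : (0 : ℤ) ≤ (L : ℤ) ^ j := by positivity
  have h1 := (hy i).2
  have h2 := (hye i).2
  simp only [bondHi, Pi.smul_apply, smul_eq_mul, add_e_apply] at h1 h2
  have h1' := mul_le_mul_of_nonneg_left h1 hP
  have h2' := mul_le_mul_of_nonneg_left h2 hP
  simp only [bondHiK, pow_succ]
  split_ifs at h1' h2' ⊢ <;> nlinarith

/-- The `j`-box `Bʲ(y) ∪ Bʲ(y + e_ν)` of such a bond lies in the `(j+1)`-box `B^{j+1}(z) ∪ B^{j+1}(z + e_μ)`.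
[cite: Balaban1985Averaging, p.24 (locality sentence after (43))] -/
theorem inBox_succ_of_inBox (L j : ℕ) (z : Site d) (μ : Fin d) {y : Site d} {ν : Fin d}
    (hy : InBox ((L : ℤ) • z) (bondHi L ((L : ℤ) • z) μ) y) (hye : InBox ((L : ℤ) • z) (bondHi L ((L : ℤ) • z) μ) (y + e ν))
    {x : Site d} (hx : InBox (loK L j y) (bondHiK L j y ν) x) : InBox (loK L (j + 1) z) (bondHiK L (j + 1) z μ) x := fun i =>
  ⟨(loK_succ_le_loK L j z μ hy i).trans (hx i).1, (hx i).2.trans (bondHiK_le_bondHiK_succ L j z μ hy hye i)⟩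

/-- `loK ≤ bondHiK` coordinatewise (`L ≥ 1`): the box of a bond is non-empty. [folklore] -/
private theorem loK_le_bondHiK {L : ℕ} (hL : 1 ≤ L) (j : ℕ) (z : Site d) (μ : Fin d) (i : Fin d) :
    loK L j z i ≤ bondHiK L j z μ i := by
  have hP : (1 : ℤ) ≤ (L : ℤ) ^ j := one_le_pow₀ (by exact_mod_cast hL)
  simp only [loK, bondHiK]
  split_ifs <;> linarith

/-! ## §2 One level up at one bond -/

section OneStep

variable {𝔸 : Type*} [CStarAlgebra 𝔸] [Nontrivial 𝔸]

/-- ★ **ONE LEVEL UP AT ONE BOND.**  `L ≥ 2`, `U₀` unitary-valued, `U` any configuration, `c = ⟨z, z + e_μ⟩` a bond of the `(j+1)`-lattice.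
If the unit plaquettes of `U₀` inside the `(j+1)`-box of `c` obey (1.7) at level `j` (`pdevOn … U₀ < α₀L^{−2j}`, windows `C₀α₀ ≤ 1∕3`,
`8α₀ ≤ c₂′`) and `‖Ūʲ(b) − Ū₀ʲ(b)‖ ≤ α₁` at every level-`j` bond `b` whose `j`-box lies in the `(j+1)`-box of `c` (`12288(d+1)L·α₁ ≤ 1`), then
`‖Ū^{j+1}(c) − Ū₀^{j+1}(c)‖ ≤ 26384(d+1)L·α₁`.  PROOF: clamp `U₀` to the box (its level-`j` averages are unit-bounded with `1∕128`-regular block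
loops everywhere, `level_background_data`, and agree with `Ū₀` on the sub-boxes, `avgIter_congr`); replace `Ūʲ` off the block pair by the
clamped base (`bavg_congr`); apply `norm_bavg_sub_bavg_le`. [cite: Balaban1985Averaging, (42)–(43) pp.23–24, Prop. 2 (54) p.26, Prop. 7 p.43; Balaban1985RegularSpaces, (1.66) p.87, p.77 (bond convention)] -/
theorem norm_avgIter_succ_sub_le_of_box {L : ℕ} (hL : 2 ≤ L) {U₀ U : Site d → Fin d → 𝔸ˣ}
    (hU₀ : ∀ x κ, U₀ x κ ∈ unitaryUnits 𝔸) {α₀ α₁ : ℝ} (hα₀ : 0 < α₀) (hα3 : C0 d * α₀ ≤ 1 / 3) (hα8 : 8 * α₀ ≤ c2' d L)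
    (hα₁ : 0 ≤ α₁) (hα₁w : α₁ ≤ 1 / (12288 * ((d : ℝ) + 1) * L)) (j : ℕ) (z : Site d) (μ : Fin d)
    (h33 : pdevOn (loK L (j + 1) z) (bondHiK L (j + 1) z μ) U₀ < α₀ * (((L : ℝ) ^ j)⁻¹) ^ 2)
    (h135 : ∀ (y : Site d) (ν : Fin d), (∀ x, InBox (loK L j y) (bondHiK L j y ν) x → InBox (loK L (j + 1) z) (bondHiK L (j + 1) z μ) x) →
      ‖(avgIter L U j y ν : 𝔸) - (avgIter L U₀ j y ν : 𝔸)‖ ≤ α₁) :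
    ‖(avgIter L U (j + 1) z μ : 𝔸) - (avgIter L U₀ (j + 1) z μ : 𝔸)‖ ≤ 26384 * ((d : ℝ) + 1) * L * α₁ := by
  classical
  have hL1 : 1 ≤ L := le_trans (by norm_num) hL
  set lo : Site d := loK L (j + 1) z with hlo
  set hi : Site d := bondHiK L (j + 1) z μ with hhi
  have hlohi : ∀ i, lo i ≤ hi i := fun i => loK_le_bondHiK hL1 (j + 1) z μ i
  -- the clamped base and its level-`j` averages
  set W₀ : Site d → Fin d → 𝔸ˣ := clampCfg lo hi U₀ with hW₀
  have hW₀G : ∀ x κ, W₀ x κ ∈ unitaryUnits 𝔸 := clampCfg_mem hU₀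
  have hU₀1 : ∀ x κ, U₀ x κ ∈ U1 𝔸 := fun x κ => unitaryUnits_le_U1 (hU₀ x κ)
  have h52 : pdev W₀ < α₀ * (((L : ℝ) ^ j)⁻¹) ^ 2 := (pdev_clampCfg_le hlohi hU₀1).trans_lt h33
  obtain ⟨hV'U1, hV'reg⟩ :=
    level_background_data L hL (avgClosed_unitaryUnits d L) j W₀ hW₀G hα₀ hα3 hα8 h52 j le_rfl
  set V' : Site d → Fin d → 𝔸ˣ := avgIter L W₀ j with hV'
  have hagree : AgreeOn lo hi W₀ U₀ := clampCfg_agree U₀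
  -- the block pair of the `L`-bond `⟨Lz, Lz + Le_μ⟩` of the `j`-lattice
  set q : Site d := (L : ℤ) • z with hq
  -- `V'` agrees with `Ū₀ʲ` on the bonds of the block pair
  have hV'eq : ∀ (y : Site d) (ν : Fin d), InBox q (bondHi L q μ) y → InBox q (bondHi L q μ) (y + e ν) →
      V' y ν = avgIter L U₀ j y ν := fun y ν hy hye =>
    avgIter_congr L hL1 j y ν (hagree.mono (fun i => loK_succ_le_loK L j z μ hy i)
      (fun i => bondHiK_le_bondHiK_succ L j z μ hy hye i))
  -- the perturbed level-`j` configuration, replaced by the clamped base off the block pair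
  set V : Site d → Fin d → 𝔸ˣ := fun y ν =>
    if InBox q (bondHi L q μ) y ∧ InBox q (bondHi L q μ) (y + e ν) then avgIter L U j y ν else V' y ν with hV
  have hVin : ∀ (y : Site d) (ν : Fin d), InBox q (bondHi L q μ) y → InBox q (bondHi L q μ) (y + e ν) →
      V y ν = avgIter L U j y ν := fun y ν hy hye => by
    simp only [hV, hy, hye, and_self, if_true]
  -- closeness of `V` to `V'` everywhere, in the relative form
  have hVδ : ∀ (y : Site d) (ν : Fin d), ‖((V y ν : 𝔸ˣ) : 𝔸) * (((V' y ν)⁻¹ : 𝔸ˣ) : 𝔸) - 1‖ ≤ α₁ := by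
    intro y ν
    by_cases hb : InBox q (bondHi L q μ) y ∧ InBox q (bondHi L q μ) (y + e ν)
    · have h1 : ((V y ν : 𝔸ˣ) : 𝔸) * (((V' y ν)⁻¹ : 𝔸ˣ) : 𝔸) - 1 =
          (((V y ν : 𝔸ˣ) : 𝔸) - ((V' y ν : 𝔸ˣ) : 𝔸)) * (((V' y ν)⁻¹ : 𝔸ˣ) : 𝔸) := by
        rw [sub_mul, Units.mul_inv]
      rw [h1, hVin y ν hb.1 hb.2, hV'eq y ν hb.1 hb.2]
      have hclose : ‖(avgIter L U j y ν : 𝔸) - (avgIter L U₀ j y ν : 𝔸)‖ ≤ α₁ :=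
        h135 y ν fun x hx => inBox_succ_of_inBox L j z μ hb.1 hb.2 hx
      have hinv : ‖(((V' y ν)⁻¹ : 𝔸ˣ) : 𝔸)‖ ≤ 1 := (hV'U1 y ν).2
      rw [hV'eq y ν hb.1 hb.2] at hinv
      calc ‖(((avgIter L U j y ν : 𝔸ˣ) : 𝔸) - ((avgIter L U₀ j y ν : 𝔸ˣ) : 𝔸)) * (((avgIter L U₀ j y ν)⁻¹ : 𝔸ˣ) : 𝔸)‖
          ≤ ‖((avgIter L U j y ν : 𝔸ˣ) : 𝔸) - ((avgIter L U₀ j y ν : 𝔸ˣ) : 𝔸)‖ * ‖(((avgIter L U₀ j y ν)⁻¹ : 𝔸ˣ) : 𝔸)‖ :=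
            norm_mul_le _ _
        _ ≤ α₁ * 1 := mul_le_mul hclose hinv (norm_nonneg _) hα₁
        _ = α₁ := mul_one _
    · have h0 : V y ν = V' y ν := by simp only [hV, hb, if_false]
      rw [h0, Units.mul_inv, sub_self, norm_zero]
      exact hα₁
  -- the one-step Lipschitz bound at the regular base `V'`
  obtain ⟨hreg, hregw⟩ := hV'reg q μ
  have hα1' : 32 * ((d : ℝ) + 1) * ((d : ℝ) + 4) * (L : ℝ) ^ 2 * (α₀ * ((L : ℝ) ^ j * ((L : ℝ) ^ j)⁻¹) ^ 2) ≤ 1 / 128 := hregw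
  have hLip := norm_bavg_sub_bavg_le hL1 hV'U1 q μ hα1' hreg hα₁ hα₁w hVδ
  -- identify the two averages
  have hVbavg : bavg L V q μ = bavg L (avgIter L U j) q μ :=
    bavg_congr L hL1 q μ fun y ν hy hye => hVin y ν hy hye
  have hV'bavg : bavg L V' q μ = avgIter L U₀ (j + 1) z μ := by
    have h1 : avgIter L W₀ (j + 1) z μ = avgIter L U₀ (j + 1) z μ := avgIter_congr L hL1 (j + 1) z μ hagree
    rw [← h1, avgIter_succ, rescale_apply]
  have hUbavg : bavg L (avgIter L U j) q μ = avgIter L U (j + 1) z μ := by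
    rw [avgIter_succ, rescale_apply]
  rw [← hUbavg, ← hVbavg, ← hV'bavg]
  exact hLip

end OneStep

/-! ## §3 The currency step at all levels: the box-form letter implies the γ driver's `h135` -/

section AllLevels

variable {𝔸 : Type*} [CStarAlgebra 𝔸] [Nontrivial 𝔸]

/-- ★★ **THE (1.66) CURRENCY STEP «box ⊂ Ω_j ⇒ box ⊂ Ω_{j−1}» AT ALL LEVELS.**  `L ≥ 2`; `U₀` unitary-valued with (1.33)
`U₀ ∈ 𝔄_k({Ω_j}, α₀)` (`InAk`); `U` any configuration (e.g. `U = U′U₀`); windows `C₀α₀ ≤ 1∕3`, `8α₀ ≤ c₂′(d,L)`, `12288(d+1)L·α₁ ≤ 1`.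
If the BOX-FORM closeness holds at every level — `‖Ūʲ(z, z+e_μ) − Ū₀ʲ(z, z+e_μ)‖ ≤ α₁` for every `j ≤ k` and every level-`j` bond whose
two-block box lies in `Ω_j` (the first clause of the N05 family letter `B8LeafModelZd3.zdGF3.avgClose166 α₁`) — then the closeness holds,
with constant `26384(d+1)L·α₁`, at every `j ≤ k` and every level-`j` bond whose box lies in `Ω_{j−1}` (ℕ subtraction; at `j = 0` this is
the letter itself) — VERBATIM the hypothesis `h135` of `B8Eq142KLevelLocalGamma.H42_of_inAx_γ` at `α₁ ↦ 26384(d+1)L·α₁`.  In particular the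
level-`j` crossing bonds of (1.31) (one end-block in `Λ_j`, the other under `Λ_{j−1} ⊂ Ω_{j−1}`), which print's (1.35)∕(1.66) cover by the
p. 77 convention and the box-form letter does not, are controlled.  Proof: `norm_avgIter_succ_sub_le_of_box` with (1.7) at level `j−1` on
the box (`pdevOn_box_lt_of_inAk`) and the letter at level `j−1` on the sub-boxes.
[cite: Balaban1985RegularSpaces, (1.35) p.82, (1.66) p.87, p.77 (bond convention), (1.31) p.82, (1.33) p.82; Balaban1985Averaging, (43) p.24, Prop. 2 p.26, Prop. 7 p.43] -/
theorem avgClose_predBox_of_boxForm {L : ℕ} (hL : 2 ≤ L) {k : ℕ} {η : ℝ} {Ω : ℕ → Set (Site d)}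
    {U₀ U : Site d → Fin d → 𝔸ˣ} (hU₀ : ∀ x κ, U₀ x κ ∈ unitaryUnits 𝔸)
    {α₀ α₁ : ℝ} (hα₀ : 0 < α₀) (hα3 : C0 d * α₀ ≤ 1 / 3) (hα8 : 8 * α₀ ≤ c2' d L)
    (hα₁ : 0 ≤ α₁) (hα₁w : α₁ ≤ 1 / (12288 * ((d : ℝ) + 1) * L))
    (h33 : InAk L k η α₀ Ω U₀)
    (h135 : ∀ j, j ≤ k → ∀ (z : Site d) (μ : Fin d), (∀ x, InBox (loK L j z) (bondHiK L j z μ) x → x ∈ Ω j) →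
      ‖(avgIter L U j z μ : 𝔸) - (avgIter L U₀ j z μ : 𝔸)‖ ≤ α₁) :
    ∀ j, j ≤ k → ∀ (z : Site d) (μ : Fin d), (∀ x, InBox (loK L j z) (bondHiK L j z μ) x → x ∈ Ω (j - 1)) →
      ‖(avgIter L U j z μ : 𝔸) - (avgIter L U₀ j z μ : 𝔸)‖ ≤ 26384 * ((d : ℝ) + 1) * L * α₁ := by
  have hL1 : 1 ≤ L := le_trans (by norm_num) hL
  -- the constant is at least `1`
  have hC : α₁ ≤ 26384 * ((d : ℝ) + 1) * L * α₁ := by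
    have hL1r : (1 : ℝ) ≤ L := by exact_mod_cast hL1
    have hd0 : (0 : ℝ) ≤ d := Nat.cast_nonneg d
    have h1 : (1 : ℝ) ≤ 26384 * ((d : ℝ) + 1) * L := by nlinarith
    simpa using mul_le_mul_of_nonneg_right h1 hα₁
  intro j hj z μ hbox
  rcases Nat.eq_zero_or_pos j with rfl | hjpos
  · -- level `0`: `Ω (0 - 1) = Ω 0`, the letter itself
    exact (h135 0 hj z μ fun x hx => hbox x hx).trans hC
  · obtain ⟨j', rfl⟩ : ∃ j', j = j' + 1 := ⟨j - 1, by omega⟩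
    have hj' : j' ≤ k := by omega
    simp only [Nat.add_sub_cancel] at hbox
    refine norm_avgIter_succ_sub_le_of_box hL hU₀ hα₀ hα3 hα8 hα₁ hα₁w j' z μ
      (pdevOn_box_lt_of_inAk hL1 hα₀ h33 hj' hbox) fun y ν hsub => ?_
    exact h135 j' hj' y ν fun x hx => hbox x (hsub x hx)

end AllLevels

end Literature.MathematicalPhysics.QuantumFieldTheory.Balaban1983to89.B8Ineq166OneLevelUp

end
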